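import Mathlib
import Summits.Ventures.PercRepro2.SwOutAll
import Summits.Ventures.PercRepro2.SwOutSeriesDefs
import Summits.Ventures.PercRepro2.SwOutSeriesContract
import Summits.Ventures.PercRepro2.SwOutSeriesContractCount
import Summits.Ventures.PercRepro2.SwOutSeriesDelete
import Summits.Ventures.PercRepro2.SwOutSeriesDeleteCount

/-!
# THEOREM S: the series reduction inside an outside class (blind cell PercRepro2, night-4 g10,
2026-08-25; proofs/NIGHT4-G10.md §2)

`card_le_of_series`: for a series vertex `u ∈ U ∖ {h, o}` with edges to `p, q ∈ U` (`l ∉ U`), the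
rigid counting inequality of (HLC) on the class `(G, U, ξ)` follows from the same inequalities on
the contracted class `(G/u, U ∖ {u}, ξ[e₁ ↦ false])` and on the deleted class
`(G − u, U ∖ {u}, ξ[e₁, e₂ ↦ false])`, each for every up-set of edge sets: the class splits by the
colours at `u` (`card_filter_split`), the same-colour part is the contracted count at the
substituted up-set, the two different-colour parts are the deleted counts at the two tagged
up-sets, and the tags swap between the red and the blue side.  This is the induction step of the
cycle theorem (NIGHT4-G10.md §4) — its base case (paths / cycles all of whose non-mark vertices
carry an outside edge) is the cube principle, not formalised here.
-/

namespace Summit.Ventures.PercRepro2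

namespace LocRows

open Hull

variable {V : Type*} {E : Type*} [Fintype E] [DecidableEq E]

open scoped Classical

variable {ends : E → Sym2 V} {u p q : V} {e₁ e₂ : E}

/-! ## Theorem S -/

omit [Fintype E] [DecidableEq E] in
/-- The three-way split of a filtered count by the colours at the two edges. -/
lemma card_filter_split (S : Finset (Config E)) (P : Config E → Prop) :
    (S.filter fun ζ => P ζ).card =
      (S.filter fun ζ => ζ e₁ = ζ e₂ ∧ P ζ).card +
        (S.filter fun ζ => ζ e₁ = true ∧ ζ e₂ = false ∧ P ζ).card +
        (S.filter fun ζ => ζ e₁ = false ∧ ζ e₂ = true ∧ P ζ).card := by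
  have h1 := Finset.card_filter_add_card_filter_not (s := S.filter fun ζ => P ζ)
    (fun ζ => ζ e₁ = ζ e₂)
  have h2 := Finset.card_filter_add_card_filter_not
    (s := (S.filter fun ζ => P ζ).filter fun ζ => ¬ ζ e₁ = ζ e₂) (fun ζ => ζ e₁ = true)
  simp only [Finset.filter_filter] at h1 h2
  have e1 : (S.filter fun ζ => P ζ ∧ ζ e₁ = ζ e₂) = S.filter fun ζ => ζ e₁ = ζ e₂ ∧ P ζ := by
    apply Finset.filter_congr; intro ζ _; exact and_comm
  have e2 : (S.filter fun ζ => (P ζ ∧ ¬ ζ e₁ = ζ e₂) ∧ ζ e₁ = true) =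
      S.filter fun ζ => ζ e₁ = true ∧ ζ e₂ = false ∧ P ζ := by
    apply Finset.filter_congr; intro ζ _
    constructor
    · rintro ⟨⟨hP, hne'⟩, h₁⟩
      refine ⟨h₁, ?_, hP⟩
      cases h₂ : ζ e₂
      · rfl
      · exact absurd (h₁.trans h₂.symm) hne'
    · rintro ⟨h₁, h₂, hP⟩
      exact ⟨⟨hP, by rw [h₁, h₂]; decide⟩, h₁⟩
  have e3 : (S.filter fun ζ => (P ζ ∧ ¬ ζ e₁ = ζ e₂) ∧ ¬ ζ e₁ = true) =
      S.filter fun ζ => ζ e₁ = false ∧ ζ e₂ = true ∧ P ζ := by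
    apply Finset.filter_congr; intro ζ _
    constructor
    · rintro ⟨⟨hP, hne'⟩, h₁⟩
      have h₁' : ζ e₁ = false := by cases h : ζ e₁ <;> simp_all
      refine ⟨h₁', ?_, hP⟩
      cases h₂ : ζ e₂
      · exact absurd (h₁'.trans h₂.symm) hne'
      · rfl
    · rintro ⟨h₁, h₂, hP⟩
      exact ⟨⟨hP, by rw [h₁, h₂]; decide⟩, by rw [h₁]; decide⟩
  rw [e1] at h1
  rw [e2, e3] at h2
  omega

/-- **THEOREM S (series reduction inside an outside class)**: if the rigid counting inequalities
hold for the contracted class `(G/u, U ∖ {u}, ξ[e₁ ↦ false])` and for the deleted class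
`(G − u, U ∖ {u}, ξ[e₁, e₂ ↦ false])` for every up-set, they hold for the class `(G, U, ξ)` — the
same-colour configurations contract, the different-colour ones delete with their tags. -/
theorem card_le_of_series (hs : IsSeriesAt ends u p q e₁ e₂) {U : Set V} {ξ : Config E}
    {l h o : V} (hu : u ∈ U) (hp : p ∈ U) (huh : u ≠ h) (hul : u ≠ l) (huo : u ≠ o)
    (ihC : ∀ 𝓔 : Set (Set E), IsUpperSet 𝓔 →
      ((swOutSide (contractSeries ends u p q e₁ e₂) l h o (U \ {u})
          (Function.update ξ e₁ false)).filter fun ζ' =>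
            redEdges (contractSeries ends u p q e₁ e₂) ζ' h ∈ 𝓔).card ≤
        ((swOutSide (contractSeries ends u p q e₁ e₂) l h o (U \ {u})
          (Function.update ξ e₁ false)).filter fun ζ' =>
            blueEdges (contractSeries ends u p q e₁ e₂) ζ' h ∈ 𝓔).card)
    (ihD : ∀ 𝓔 : Set (Set E), IsUpperSet 𝓔 →
      ((swOutSide (deleteSeries ends u e₁ e₂) l h o (U \ {u})
          (Function.update (Function.update ξ e₂ false) e₁ false)).filter fun ζ' =>
            redEdges (deleteSeries ends u e₁ e₂) ζ' h ∈ 𝓔).card ≤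
        ((swOutSide (deleteSeries ends u e₁ e₂) l h o (U \ {u})
          (Function.update (Function.update ξ e₂ false) e₁ false)).filter fun ζ' =>
            blueEdges (deleteSeries ends u e₁ e₂) ζ' h ∈ 𝓔).card)
    {𝓔 : Set (Set E)} (h𝓔 : IsUpperSet 𝓔) :
    ((swOutSide ends l h o U ξ).filter fun ζ => redEdges ends ζ h ∈ 𝓔).card ≤
      ((swOutSide ends l h o U ξ).filter fun ζ => blueEdges ends ζ h ∈ 𝓔).card := by
  rw [card_filter_split (e₁ := e₁) (e₂ := e₂) (swOutSide ends l h o U ξ)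
      (fun ζ => redEdges ends ζ h ∈ 𝓔),
    card_filter_split (e₁ := e₁) (e₂ := e₂) (swOutSide ends l h o U ξ)
      (fun ζ => blueEdges ends ζ h ∈ 𝓔),
    card_same_red hs hu hp huh hul huo, card_same_blue hs hu hp huh hul huo,
    card_diff_red₁ hs hu huh hul huo, card_diff_red₂ hs hu huh hul huo,
    card_diff_blue₁ hs hu huh hul huo, card_diff_blue₂ hs hu huh hul huo]
  have h1 := ihC _ (isUpperSet_preimage_contractSub (e₁ := e₁) (e₂ := e₂) h𝓔)
  have h2 := ihD _ (isUpperSet_preimage_tagSub (ends := deleteSeries ends u e₁ e₂) (h := h)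
    (e₀ := e₁) (p := p) h𝓔)
  have h3 := ihD _ (isUpperSet_preimage_tagSub (ends := deleteSeries ends u e₁ e₂) (h := h)
    (e₀ := e₂) (p := q) h𝓔)
  omega


end LocRows

end Summit.Ventures.PercRepro2
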